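import Summits.ResolutionOfSingularities.ResolutionOfSingularities.Theorems.PurelyInseparableDim4PointLastStep
import Literature.AlgebraicGeometry.Resolution.MarkedResolutions
import Literature.AlgebraicGeometry.Resolution.KollarBlowupSequenceFunctors
import HarnessLib

/-!
# Purely inseparable four-folds: CHAINING point blow-ups along the walk — extend an admissible sequence at a chart
# centre, close it at a terminal isolated state; the depth-two single-point showcase (brick TY-3j part 4b, cell `res-dim4-pi`)

[OURS · counted 0] (D-0157 DOOR 2; the chain lemmas of the ISOLATED-regime assembly of
`PIDim4.TerminationImpliesOrderReduction` (typ-3 memo §D); host item stmt-ResolutionOfSingularities-16155, helper).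
Nothing here proves resolution of singularities in dimension ≥ 4 / characteristic `p`.

With INVARIANT(X′, M′, x′) as in `…PointStepPackage` (open-immersion chart `φ : 𝔸⁵_K ⟶ X′` at the closed `x′` with
`M′.ideal.comap φ = (z^p + F′)·𝒪`, `F′ ≠ 0` clean `p`-fold) at the END of an admissible sequence `IsMultipleBlowup M σ M′`:

* `jacobsonSpace_of_isMultipleBlowup` — Jacobson is inherited along admissible sequences;
* `isClean_step`, `ordAlong_univ_step_of_isEquimultiplePoint` — the walk's next state is again clean and `p`-fold
  (so an EDGE hands the INVARIANT's polynomial side to the next stage);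
* **`isMultipleBlowup_extend_point`** — blowing up `x′` EXTENDS the admissible sequence (`IsMultipleBlowup.blowup` with
  part 4a's admissibility of the point centre and `IsMultipleBlowup.hasSNC_boundary`);
* **`isMarkedResolution_extend_point_of_no_edge`** — if `x′` is the only closed order-`p` point of `M′` and the walk
  has no edge out of its state, the extended sequence is a MARKED RESOLUTION of the ORIGINAL `M`;
* **`exists_isMarkedResolution_depth_two`** — showcase over `𝔸⁵_K`: `F` clean `p`-fold with the origin its only
  closed order-`p` point; for a blowing up `π₁` of the origin with AT MOST ONE closed order-`p` point upstairs, and every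
  edge successor `s'` of `(F, 0, ∅)` terminal (no further edge): `(𝔸⁵_K, (z^p + F)·𝒪, [], p)` admits
  a marked resolution (one or two point blow-ups) — the conclusion of `PIDim4.OrderReduction p` for such `F`.

AI-produced formalisation, weaker than expert review. bears_on: LADDER-RESOLUTION:D157-DOOR2 (res-dim4-pi · TY-3j).
-/

set_option linter.dupNamespace false -- D-0017: single-problem summit path `Summit.<S>.<S>.…` by design

noncomputable section

open MvPolynomial Finset CategoryTheory AlgebraicGeometry Opposite TopologicalSpace

namespace Summit.ResolutionOfSingularities.ResolutionOfSingularities.Theorems.PIDim4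

open Literature.AlgebraicGeometry.Resolution
open Literature.AlgebraicGeometry.Resolution.Hauser2010
open Literature.AlgebraicGeometry.Resolution.AffinePointBlowup (P A γ coord Wtop ξ)

namespace Equimultiple

section Chain

variable {K : Type} [Field K] {p : ℕ} [hp : Fact p.Prime] [CharP K p]
variable {X X' W : Scheme.{0}} {σ : X' ⟶ X} {π : W ⟶ X'} {x' : X'}

omit hp [CharP K p] in
/-- Jacobson is inherited along an admissible sequence of blow-ups (each step is proper). [cite: StacksProject, Tag 01W0] -/
theorem jacobsonSpace_of_isMultipleBlowup [IsLocallyNoetherian X] [JacobsonSpace X] {M : MarkedIdeal X}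
    {M' : MarkedIdeal X'} (h : IsMultipleBlowup M σ M') : JacobsonSpace X' := by
  induction h with
  | refl => infer_instance
  | blowup hprev C τ hτ _ _ _ ih =>
    haveI := hprev.isLocallyNoetherian
    haveI := ih
    exact jacobsonSpace_of_isBlowup' hτ

omit hp [CharP K p] in
/-- The walk's next state is clean (its `p`-th powers are deleted). [cite: HauserPerlega2019PRIMS, §2 (cleaning)] -/
theorem isClean_step [DecidableEq K] (S : Finset (Fin 4)) (j : Fin 4) (b : Fin 4 → K) (s : State K) :
    Literature.Barriers.ResolutionOfSingularities.HauserPerlega.IsClean p (CentreBlowup.step p S j b s).F := by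
  intro d hd hpth
  apply MvPolynomial.mem_support_iff.mp hd
  change coeff d (deletePthPowers p (CentreBlowup.pointTransform p S j b s)) = 0
  rw [coeff_deletePthPowers, if_pos hpth]

omit hp [CharP K p] in
/-- An equimultiple point hands a `p`-fold next state: `p ≤ ord₀ (step p univ j b s).F` in the `ordAlong univ` form.
[cite: Hauser2010, §F] -/
theorem ordAlong_univ_step_of_isEquimultiplePoint [DecidableEq K] (j : Fin 4) (b : Fin 4 → K) (s : State K)
    (heq : CentreBlowup.IsEquimultiplePoint p Finset.univ j b s) :
    (p : ℕ∞) ≤ CentreBlowup.ordAlong (Finset.univ : Finset (Fin 4)) (CentreBlowup.step p Finset.univ j b s).F := by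
  have h := (isEquimultiplePoint_iff_le_ordZero_step (q := p) Finset.univ j b s).mp heq
  rw [natCast_le_ordZero_iff_forall_coeff] at h
  refine Finset.le_inf fun d hd => ?_
  rw [CentreBlowup.degIn_univ]
  by_contra hlt
  exact MvPolynomial.mem_support_iff.mp hd (h d (by exact_mod_cast not_le.mp hlt))

/-- **EXTEND an admissible sequence by the point blow-up at a chart centre.**
[cite: BierstoneGrigorievMilmanWlodarczyk2011, Def. 3.1.3] -/
theorem isMultipleBlowup_extend_point [IsLocallyNoetherian X] [DecidableEq K] {M : MarkedIdeal X}
    {M' : MarkedIdeal X'} (h : IsMultipleBlowup M σ M') (hE : HasSNC M.boundary) (hmult : M.mult = p)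
    (φ : P 4 K ⟶ X') [IsOpenImmersion φ] (hx' : IsClosed ({x'} : Set X')) (hφ : φ (ξ 4 K) = x') (s : State K)
    (hM' : M'.ideal.comap φ = hypSheaf p s.F)
    (hperm : (p : ℕ∞) ≤ CentreBlowup.ordAlong (Finset.univ : Finset (Fin 4)) s.F)
    (hπ : IsBlowup π (Scheme.IdealSheafData.vanishingIdeal (⟨{x'}, hx'⟩ : Closeds X'))) :
    IsMultipleBlowup M (π ≫ σ) (M'.transform π (Scheme.IdealSheafData.vanishingIdeal (⟨{x'}, hx'⟩ : Closeds X'))) := by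
  haveI := h.isLocallyNoetherian
  exact IsMultipleBlowup.blowup h _ π hπ (isRegular_subscheme_vanishingIdeal_singleton hx')
    (support_vanishingIdeal_subset_support φ hx' hφ M' (h.mult_eq.trans hmult) s hM' hperm)
    ((h.hasSNC_boundary hE).hasSNCWith_vanishingIdeal_singleton hx')

/-- **CLOSE an admissible sequence at a terminal isolated state**: the extended sequence is a marked resolution of the
ORIGINAL marked ideal. [cite: BierstoneGrigorievMilmanWlodarczyk2011, Def. 3.1.3 (6)] -/
theorem isMarkedResolution_extend_point_of_no_edge [IsLocallyNoetherian X] [JacobsonSpace X] [IsAlgClosed K]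
    [DecidableEq K] {M : MarkedIdeal X} {M' : MarkedIdeal X'} (h : IsMultipleBlowup M σ M')
    (hE : HasSNC M.boundary) (hmult : M.mult = p) (φ : P 4 K ⟶ X') [IsOpenImmersion φ]
    (hx' : IsClosed ({x'} : Set X')) (hφ : φ (ξ 4 K) = x') (s : State K) (hM' : M'.ideal.comap φ = hypSheaf p s.F)
    (hF : s.F ≠ 0) (hclean : Literature.Barriers.ResolutionOfSingularities.HauserPerlega.IsClean p s.F)
    (hperm : (p : ℕ∞) ≤ CentreBlowup.ordAlong (Finset.univ : Finset (Fin 4)) s.F)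
    (hπ : IsBlowup π (Scheme.IdealSheafData.vanishingIdeal (⟨{x'}, hx'⟩ : Closeds X')))
    (hiso : ∀ z : X', IsClosed ({z} : Set X') → (p : ℕ∞) ≤ idealOrder M'.ideal z → z = x')
    (hnoEdge : ∀ s' : State K, ¬ Edge p Finset.univ s s') :
    IsMarkedResolution M (π ≫ σ)
      (M'.transform π (Scheme.IdealSheafData.vanishingIdeal (⟨{x'}, hx'⟩ : Closeds X'))) := by
  haveI := h.isLocallyNoetherian
  haveI := jacobsonSpace_of_isMultipleBlowup h
  exact ⟨isMultipleBlowup_extend_point h hE hmult φ hx' hφ s hM' hperm hπ,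
    support_transform_point_eq_empty φ hx' hφ M' (h.mult_eq.trans hmult) (h.hasSNC_boundary hE) s hM' hF hclean
      hperm hπ hiso hnoEdge⟩

end Chain

/-! ## The depth-two single-point showcase over `𝔸⁵_K` -/

section DepthTwo

variable {K : Type} [Field K] {p : ℕ} [hp : Fact p.Prime] [CharP K p]

/-- **DEPTH TWO.** `K = K̄` of characteristic `p`; `F ≠ 0` clean with `p ≤ ord₀ F` and the origin the ONLY closed
order-`p` point of `(z^p + F)·𝒪` on `𝔸⁵_K`; `π₁ : W₁ → 𝔸⁵_K` ANY blowing up of the origin carrying AT MOST ONE closed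
point of order `≥ p` for the transform; every edge successor `s'` of `(F, 0, ∅)` terminal (`∀ s'', ¬ Edge p univ s' s''`).
Then `(𝔸⁵_K, (z^p + F)·𝒪, [], p)` admits a marked resolution — by `π₁` alone if nothing of order `p` survives, else by
`π₁` followed by the blow-up of the surviving point (`point_step_package` + `isMarkedResolution_extend_point_of_no_edge`).
NOT `OrderReduction p` (which quantifies over all clean `F`). [cite: BierstoneGrigorievMilmanWlodarczyk2011, Def. 3.1.3]
[cite: Hironaka1964, Main Theorem I (the characteristic-zero statement whose analogue is asked)] -/
theorem exists_isMarkedResolution_depth_two [IsAlgClosed K] [DecidableEq K] (F : MvPolynomial (Fin 4) K)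
    (hF : F ≠ 0) (hclean : Literature.Barriers.ResolutionOfSingularities.HauserPerlega.IsClean p F)
    (hperm : (p : ℕ∞) ≤ CentreBlowup.ordAlong (Finset.univ : Finset (Fin 4)) F)
    (hiso₀ : ∀ z : P 4 K, IsClosed ({z} : Set (P 4 K)) → (p : ℕ∞) ≤ idealOrder (hypSheaf p F) z → z = ξ 4 K)
    {W₁ : Scheme.{0}} {π₁ : W₁ ⟶ P 4 K}
    (hπ₁ : IsBlowup π₁ (Scheme.IdealSheafData.vanishingIdeal (AffinePointBlowup.C₀ 4 K)))
    (hone : ∀ w w' : W₁, IsClosed ({w} : Set W₁) → IsClosed ({w'} : Set W₁) →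
      (p : ℕ∞) ≤ idealOrder ((⟨hypSheaf p F, [], p⟩ : MarkedIdeal (P 4 K)).transform π₁
        (Scheme.IdealSheafData.vanishingIdeal (AffinePointBlowup.C₀ 4 K))).ideal w →
      (p : ℕ∞) ≤ idealOrder ((⟨hypSheaf p F, [], p⟩ : MarkedIdeal (P 4 K)).transform π₁
        (Scheme.IdealSheafData.vanishingIdeal (AffinePointBlowup.C₀ 4 K))).ideal w' → w = w')
    (hterm : ∀ s' : State K, Edge p Finset.univ (⟨F, 0, ∅⟩ : State K) s' → ∀ s'' : State K, ¬ Edge p Finset.univ s' s'') :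
    ∃ (X' : Scheme.{0}) (π : X' ⟶ P 4 K) (M' : MarkedIdeal X'),
      IsMarkedResolution (⟨hypSheaf p F, [], p⟩ : MarkedIdeal (P 4 K)) π M' := by
  set M₀ : MarkedIdeal (P 4 K) := ⟨hypSheaf p F, [], p⟩ with hM₀
  set s₀ : State K := ⟨F, 0, ∅⟩ with hs₀
  have hE₀ : HasSNC M₀.boundary := hasSNC_nil_of_isRegular (Literature.AlgebraicGeometry.Hironaka2017.Lib.AffinePointBlowupLSB.isRegular_Z 4 K)
  have hφ₀ : (𝟙 (P 4 K)) (ξ 4 K) = ξ 4 K := rfl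
  have hM₀' : M₀.ideal.comap (𝟙 (P 4 K)) = hypSheaf p s₀.F := Scheme.IdealSheafData.comap_id _
  have hξc : IsClosed ({ξ 4 K} : Set (P 4 K)) := AffinePointBlowup.isClosed_ξ 4 K
  have hC₀ : AffinePointBlowup.C₀ 4 K = (⟨{ξ 4 K}, hξc⟩ : Closeds (P 4 K)) := rfl
  rw [hC₀] at hπ₁ hone
  -- step 1 is admissible
  have h₁ : IsMultipleBlowup M₀ π₁ (M₀.transform π₁ (Scheme.IdealSheafData.vanishingIdeal ⟨{ξ 4 K}, hξc⟩)) := by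
    have h := isMultipleBlowup_point (𝟙 (P 4 K)) hξc hφ₀ M₀ rfl hE₀ s₀ hM₀' hperm hπ₁
    exact h
  set M₁ := M₀.transform π₁ (Scheme.IdealSheafData.vanishingIdeal ⟨{ξ 4 K}, hξc⟩) with hM₁
  haveI : IsLocallyNoetherian W₁ := h₁.isLocallyNoetherian
  haveI : JacobsonSpace W₁ := jacobsonSpace_of_isMultipleBlowup h₁
  by_cases hempty : M₁.support = ∅
  · exact ⟨W₁, π₁, M₁, h₁, hempty⟩
  · -- a surviving closed point `w₁` of order `≥ p`; it lies over the origin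
    have hreg₁ : Scheme.IsRegular W₁ := isRegular_of_isBlowup_point hξc hE₀ hπ₁
    obtain ⟨w₁, hw₁, hord₁⟩ : ∃ w₁ : W₁, IsClosed ({w₁} : Set W₁) ∧ (p : ℕ∞) ≤ idealOrder M₁.ideal w₁ := by
      by_contra hall
      push Not at hall
      exact hempty ((support_eq_empty_iff_forall_isClosed hreg₁ M₁).mpr fun w hw => hall w hw)
    have hwξ : π₁ w₁ = ξ 4 K := by
      by_contra hne
      have hnot : π₁ w₁ ∉ ((Scheme.IdealSheafData.vanishingIdeal (⟨{ξ 4 K}, hξc⟩ : Closeds (P 4 K))).support :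
          Set (P 4 K)) := fun h => hne ((mem_support_vanishingIdeal_singleton_iff hξc).mp h)
      have h2 := hord₁
      rw [hM₁, MarkedIdeal.transform_ideal, hπ₁.idealOrder_controlledTransform_eq_of_not_mem _ hnot] at h2
      exact hne (hiso₀ _ (isClosed_singleton_π' hπ₁ hw₁) h2)
    -- the step package: an edge `(j, b)` and a chart at `w₁`
    obtain ⟨j, b, -, hedge, φ₁, _, hφ₁, hM₁'⟩ :=
      point_step_package (𝟙 (P 4 K)) hξc hφ₀ M₀ rfl s₀ hM₀' hF hclean hperm hπ₁ hw₁ hwξ hord₁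
    obtain ⟨j'', b'', -, -, heq'', hF'', hs''⟩ := id hedge
    -- blow up `w₁`: the extended sequence is a marked resolution
    exact ⟨_, blowup.π (Scheme.IdealSheafData.vanishingIdeal ⟨{w₁}, hw₁⟩) ≫ π₁, _,
      isMarkedResolution_extend_point_of_no_edge h₁ hE₀ rfl φ₁ hw₁ hφ₁ (CentreBlowup.step p Finset.univ j b s₀) hM₁'
        (by rw [hs'']; exact hF'') (isClean_step Finset.univ j b s₀)
        (by rw [hs'']; exact ordAlong_univ_step_of_isEquimultiplePoint j'' b'' s₀ heq'') (blowup.isBlowup _)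
        (fun z hz hzo => hone z w₁ hz hw₁ hzo hord₁) (hterm _ hedge)⟩

end DepthTwo

end Equimultiple

end Summit.ResolutionOfSingularities.ResolutionOfSingularities.Theorems.PIDim4

end
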